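import Mathlib
import HarnessLib
import Literature.AlgebraicGeometry.Resolution.AugmentationIdeal
import Literature.AlgebraicGeometry.Resolution.RsopMonomialIdeals
import Literature.AlgebraicGeometry.Resolution.RegularQuotientIdeal
import Summits.ResolutionOfSingularities.ResolutionOfSingularities.Theorems.WildQuotientsWildQuotientResolutionTameFixedLocusBoundary
import Summits.ResolutionOfSingularities.ResolutionOfSingularities.Theorems.WildQuotientsWildQuotientResolutionStandardFormTransportUnion

/-!
# A tame fixed locus has simple normal crossings with a STABLE boundary divisor — labelled regular systems of parameters
# (crux `WildQuotients.WildQuotientResolution`, stub `stub_phaseZeroHighDim`; any dimension; local algebra)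

Crux stmt-ResolutionOfSingularities-15640 (`WildQuotientResolution`), registered stub `stub_phaseZeroHighDim`.
Multi-move p-standardisation (several tame moves along `G`-stable centres `Z_{M₁}, Z_{M₂}, …`, iterable by
✓`tameMove'` p822186) keeps the boundary a simple normal crossings divisor only if each new centre has simple
normal crossings with the CURRENT boundary — the hypothesis `HasSNCWith E C` of ✓`HasSNCWith.hasSNC_transform`
(tree, BlowupSNC): at every point a regular system of parameters `u` containing a local equation of each boundary
divisor through the point and generating the centre's stalk by a subset. ✓`TameFixedLocus.exists_isRsopPart_append`
(p817967) is the case of boundary equations FIXED to first order. This file supplies the general case of a boundary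
equation `t` spanning a line that is only STABLE on the nose (`τ g t ∈ (t)`, as produced by
✓`StandardFormStableLines`), through the character dichotomy ✓`sub_mem_sq_or_mem_iSup_augIdeal` (p822157):

* `exists_isRsopPart_update_of_mem` — EXCHANGE: if `J` is cut out by part of a regular system of parameters
  (`R ⧸ J` regular) and `t ∈ J ∖ 𝔪²`, then `J` is generated by part of a regular system of parameters CONTAINING
  `t` (write `t = ∑ aᵢ fᵢ`; some `aᵢ` is a unit; swap `fᵢ` for `t`; Matsumura's criterion
  ✓`IsRsopPart.of_isRegularLocalRing_quotient`);
* `exists_rsop_label_of_mem` — packaged: a full minimal basis `u` of `𝔪` with `u i₀ = t` and `J = (u_j : j ∈ S)`;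
* `exists_rsop_label_of_fixedLine` — the transversal case (p817967) in the same packaging;
* `exists_rsop_label_of_stableLine` — **for a finite group `K` of invertible order fixing the closed point of the
  regular local `R` and `t ∈ 𝔪 ∖ 𝔪²` with `(t)` stable under `K`, there is a minimal basis `u` of `𝔪` with
  `u i₀ = t` and `⨆_g 𝔞_{τ g} = (u_j : j ∈ S)`** — the local content of «`Z_K` has simple normal crossings with the
  stable divisor `t = 0`».

[OURS · crux stmt-ResolutionOfSingularities-15640 · helper toward `stub_phaseZeroHighDim` (local SNC input of
multi-move slices; NOT a proof of the stub); folklore local algebra (Matsumura Thm. 14.2), counted 0; AI-level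
work, weaker than expert review.] [folklore]
-/

-- single-problem summit: the doubled namespace component `ResolutionOfSingularities` is forced
set_option linter.dupNamespace false

noncomputable section

open IsLocalRing Literature.AlgebraicGeometry.Resolution

namespace Summit.ResolutionOfSingularities.ResolutionOfSingularities.Theorems.WildQuotientResolution.StandardForm

universe u

section Exchange

variable {R : Type u} [CommRing R] [IsRegularLocalRing R]

/-- **Exchange.** Let `J ≤ 𝔪` with `R ⧸ J` a regular local ring (so `J` is cut out by part of a regular system
of parameters) and `t ∈ J ∖ 𝔪²`. Then `J` is generated by a part of a regular system of parameters one of whose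
members IS `t`. [cite: Matsumura1987, Thm. 14.2] -/
theorem exists_isRsopPart_update_of_mem {J : Ideal R} (hJ : J ≤ maximalIdeal R)
    [IsRegularLocalRing (R ⧸ J)] {t : R} (htJ : t ∈ J) (ht2 : t ∉ maximalIdeal R ^ 2) :
    ∃ (c : ℕ) (f : Fin c → R) (i₀ : Fin c), f i₀ = t ∧ Ideal.span (Set.range f) = J ∧ IsRsopPart f := by
  classical
  -- generators of `J` forming part of a regular system of parameters
  obtain ⟨c, f, hfG, hspan, hli⟩ :=
    exists_span_eq_of_isRegularLocalRing_quotient hJ (J : Set R) (Ideal.span_eq J)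
  have hfm : ∀ i, f i ∈ maximalIdeal R := fun i => hJ (hspan ▸ Ideal.subset_span ⟨i, rfl⟩)
  have hrsop : IsRsopPart f := by
    haveI : IsRegularLocalRing (R ⧸ Ideal.span (Set.range f)) := by rw [hspan]; infer_instance
    refine IsRsopPart.of_isRegularLocalRing_quotient hfm (le_of_eq ?_)
    obtain ⟨e, y, hdim, hsp⟩ := exists_extend_to_rsop f hfm
      ((linearIndependent_toCotangent_iff_forall_mem f hfm).mp hli)
    have h : IsRsopPart f := ⟨‹IsRegularLocalRing R›, e, y, hdim, hsp⟩
    exact h.ringKrullDim_quotient_add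
  -- `t = ∑ aᵢ fᵢ` with some `aᵢ` a unit
  have htf : t ∈ Ideal.span (Set.range f) := hspan ▸ htJ
  obtain ⟨a, ha⟩ := Ideal.mem_span_range_iff_exists_fun.mp htf
  have hunit : ∃ i₀, IsUnit (a i₀) := by
    by_contra hne
    push Not at hne
    apply ht2
    rw [← ha, pow_two]
    exact Ideal.sum_mem _ fun i _ =>
      Ideal.mul_mem_mul ((IsLocalRing.mem_maximalIdeal _).mpr (hne i)) (hfm i)
  obtain ⟨i₀, hi₀⟩ := hunit
  obtain ⟨b, hb⟩ := hi₀.exists_left_inv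
  -- swap `f i₀` for `t`
  let f' : Fin c → R := Function.update f i₀ t
  have hf'i₀ : f' i₀ = t := Function.update_self i₀ t f
  have hf'j : ∀ j, j ≠ i₀ → f' j = f j := fun j hj => Function.update_of_ne hj t f
  have hf'm : ∀ i, f' i ∈ maximalIdeal R := by
    intro i
    by_cases hi : i = i₀
    · subst hi; rw [hf'i₀]; exact hJ htJ
    · rw [hf'j i hi]; exact hfm i
  -- the two families generate the same ideal
  have hle1 : Ideal.span (Set.range f') ≤ J := by
    rw [Ideal.span_le]
    rintro _ ⟨i, rfl⟩
    by_cases hi : i = i₀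
    · subst hi; rw [hf'i₀]; exact htJ
    · rw [hf'j i hi, ← hspan]; exact Ideal.subset_span ⟨i, rfl⟩
  have hfi₀ : f i₀ ∈ Ideal.span (Set.range f') := by
    -- `f i₀ = b * (t - ∑_{j ≠ i₀} a j * f j)`
    have hsum : a i₀ * f i₀ + ∑ j ∈ Finset.univ.erase i₀, a j * f j = t := by
      rw [← ha]
      exact Finset.add_sum_erase Finset.univ (fun j => a j * f j) (Finset.mem_univ i₀)
    have e : f i₀ = b * (t - ∑ j ∈ Finset.univ.erase i₀, a j * f j) := by
      rw [← hsum, add_sub_cancel_right, ← mul_assoc, hb, one_mul]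
    rw [e]
    refine Ideal.mul_mem_left _ _ (sub_mem (hf'i₀ ▸ Ideal.subset_span ⟨i₀, rfl⟩)
      (Ideal.sum_mem _ fun j hj => Ideal.mul_mem_left _ _ ?_))
    rw [← hf'j j (Finset.ne_of_mem_erase hj)]
    exact Ideal.subset_span ⟨j, rfl⟩
  have hle2 : J ≤ Ideal.span (Set.range f') := by
    rw [← hspan, Ideal.span_le]
    rintro _ ⟨i, rfl⟩
    by_cases hi : i = i₀
    · subst hi; exact hfi₀
    · rw [← hf'j i hi]; exact Ideal.subset_span ⟨i, rfl⟩
  have hspan' : Ideal.span (Set.range f') = J := le_antisymm hle1 hle2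
  refine ⟨c, f', i₀, hf'i₀, hspan', ?_⟩
  haveI : IsRegularLocalRing (R ⧸ Ideal.span (Set.range f')) := by rw [hspan']; infer_instance
  refine IsRsopPart.of_isRegularLocalRing_quotient hf'm (le_of_eq ?_)
  have h := hrsop.ringKrullDim_quotient_add
  rw [hspan] at h
  rw [hspan']
  exact h

/-- **Packaged exchange**: under the same hypotheses there is a minimal basis `u` of `𝔪` (indexed by
`Fin (spanFinrank 𝔪)`, as in `HasSNCWith`) with `u i₀ = t` and `J` generated by the `u_j`, `j ∈ S`. [folklore] -/
theorem exists_rsop_label_of_mem {J : Ideal R} (hJ : J ≤ maximalIdeal R)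
    [IsRegularLocalRing (R ⧸ J)] {t : R} (htJ : t ∈ J) (ht2 : t ∉ maximalIdeal R ^ 2) :
    ∃ u : Fin (maximalIdeal R).spanFinrank → R, Ideal.span (Set.range u) = maximalIdeal R ∧
      (∃ i₀, u i₀ = t) ∧ ∃ S : Set (Fin (maximalIdeal R).spanFinrank), J = Ideal.span (u '' S) := by
  classical
  obtain ⟨c, f, i₀, hfi₀, hspan, hrsop⟩ := exists_isRsopPart_update_of_mem hJ htJ ht2
  obtain ⟨e, x, hd, hx, hxf⟩ := hrsop.exists_rsop
  let σ : Fin (maximalIdeal R).spanFinrank ≃ Fin (c + e) := finCongr hd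
  refine ⟨x ∘ σ, ?_, ⟨σ.symm (Fin.castAdd e i₀), ?_⟩, (σ.symm ∘ Fin.castAdd e) '' Set.univ, ?_⟩
  · rw [Set.range_comp, σ.surjective.range_eq, Set.image_univ, hx]
  · simp only [Function.comp_apply, Equiv.apply_symm_apply, hxf, hfi₀]
  · rw [← hspan, ← Set.image_comp, Set.image_univ]
    congr 1
    ext a
    simp only [Set.mem_range, Function.comp_apply, Equiv.apply_symm_apply, hxf]

end Exchange

section Stable

variable {R : Type u} [CommRing R] [IsRegularLocalRing R] {K : Type*} [Group K] [Finite K]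
  (τ : K →* (R ≃+* R))

/-- **Transversal case, packaged** (✓`TameFixedLocus.exists_isRsopPart_append`, p817967): if `K` has invertible
order, fixes the closed point, and fixes the line of `t ∈ 𝔪 ∖ 𝔪²` to first order (`τ g t − t ∈ 𝔪²`), there is a
minimal basis `u` of `𝔪` with `u i₀ = t` and `⨆_g 𝔞_{τ g}` generated by some of the `u_j`. [folklore] -/
theorem exists_rsop_label_of_fixedLine (hI : IsUnit ((Nat.card K : ℕ) : R))
    (hm : (⨆ g, augIdeal (τ g)) ≤ maximalIdeal R) {t : R} (ht : t ∈ maximalIdeal R)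
    (ht2 : t ∉ maximalIdeal R ^ 2) (hfix : ∀ g : K, τ g t - t ∈ maximalIdeal R ^ 2) :
    ∃ u : Fin (maximalIdeal R).spanFinrank → R, Ideal.span (Set.range u) = maximalIdeal R ∧
      (∃ i₀, u i₀ = t) ∧ ∃ S : Set (Fin (maximalIdeal R).spanFinrank),
        (⨆ g, augIdeal (τ g)) = Ideal.span (u '' S) := by
  classical
  -- the one-element boundary family
  let z : Fin 1 → R := fun _ => t
  have hz : ∀ i, z i ∈ maximalIdeal R := fun _ => ht
  have hzli : LinearIndependent (ResidueField R) fun i => (maximalIdeal R).toCotangent ⟨z i, hz i⟩ := by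
    rw [linearIndependent_toCotangent_iff_forall_mem z hz]
    intro c hc i
    have hc' : c 0 * t ∈ maximalIdeal R ^ 2 := by simpa [z] using hc
    by_contra hci
    obtain rfl : i = 0 := Subsingleton.elim i 0
    obtain ⟨v, hv⟩ := ((IsLocalRing.mem_maximalIdeal _).not.mp hci |> not_not.mp).exists_left_inv
    exact ht2 (by simpa [← mul_assoc, hv] using Ideal.mul_mem_left _ v hc')
  obtain ⟨c, f, hspan, hrsop⟩ :=
    TameFixedLocus.exists_isRsopPart_append τ hI hm z hz hzli (fun g _ => hfix g)
  obtain ⟨e, x, hd, hx, hxf⟩ := hrsop.exists_rsop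
  let σ : Fin (maximalIdeal R).spanFinrank ≃ Fin (c + 1 + e) := finCongr hd
  refine ⟨x ∘ σ, ?_, ⟨σ.symm (Fin.castAdd e (Fin.natAdd c (0 : Fin 1))), ?_⟩,
    (σ.symm ∘ Fin.castAdd e ∘ Fin.castAdd 1) '' Set.univ, ?_⟩
  · rw [Set.range_comp, σ.surjective.range_eq, Set.image_univ, hx]
  · simp only [Function.comp_apply, Equiv.apply_symm_apply, hxf, Fin.append_right, z]
  · rw [← hspan, ← Set.image_comp, Set.image_univ]
    congr 1
    ext a
    simp only [Set.mem_range, Function.comp_apply, Equiv.apply_symm_apply, hxf, Fin.append_left]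

/-- **A tame fixed locus has simple normal crossings with a stable boundary divisor.** Let `K` be a finite group
of invertible order acting on the regular local ring `R` and fixing the closed point (`⨆ 𝔞_{τ g} ≤ 𝔪`), and let
`t ∈ 𝔪 ∖ 𝔪²` generate an ideal stable under `K` on the nose (`τ g t ∈ (t)`). Then there is a minimal basis `u` of
`𝔪` with `u i₀ = t` and the fixed-locus ideal `⨆_g 𝔞_{τ g}` generated by some of the `u_j` — by the character
dichotomy (✓`sub_mem_sq_or_mem_iSup_augIdeal`): either the line is fixed to first order (transversal case,
`exists_rsop_label_of_fixedLine`) or `t` lies in the fixed-locus ideal (exchange, `exists_rsop_label_of_mem`,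
✓`TameFixedLocus.isRegularLocalRing_quotient_iSup_augIdeal`). [folklore] -/
theorem exists_rsop_label_of_stableLine (hI : IsUnit ((Nat.card K : ℕ) : R))
    (hm : (⨆ g, augIdeal (τ g)) ≤ maximalIdeal R) {t : R} (ht : t ∈ maximalIdeal R)
    (ht2 : t ∉ maximalIdeal R ^ 2) (hstab : ∀ g : K, τ g t ∈ Ideal.span {t}) :
    ∃ u : Fin (maximalIdeal R).spanFinrank → R, Ideal.span (Set.range u) = maximalIdeal R ∧
      (∃ i₀, u i₀ = t) ∧ ∃ S : Set (Fin (maximalIdeal R).spanFinrank),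
        (⨆ g, augIdeal (τ g)) = Ideal.span (u '' S) := by
  rcases sub_mem_sq_or_mem_iSup_augIdeal τ ht hstab with hfix | hmem
  · exact exists_rsop_label_of_fixedLine τ hI hm ht ht2 hfix
  · haveI := TameFixedLocus.isRegularLocalRing_quotient_iSup_augIdeal τ hI hm
    exact exists_rsop_label_of_mem hm hmem ht2

end Stable

end Summit.ResolutionOfSingularities.ResolutionOfSingularities.Theorems.WildQuotientResolution.StandardForm

end
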